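import Mathlib
import HarnessLib
import Summits.HodgeConjecture.HodgeConjecture.Theorems.TropicalWeilObstructionTropicalWeilVanishingCMWeights

/-!
# Crux `TropicalWeilVanishing` (stmt-HodgeConjecture-18478) — ASYMPTOTIC CHAMBERS: CM-weight separation far out
# along the torsion-fixing isogeny orbit (the engine of Theorem F1⁺⁺: no SEMI-ALGEBRAIC Kontsevich-type
# certificate sees the Weil directions)

Route `TropicalWeilObstruction` of `HodgeConjecture`; cell `pub-hodge-tropical` (Hodge NEGATION SINK — scoped exploration,
cap 2 seats, no summit claim), seat tropical-2 gen 16 (`prover-pub-hodge-tropical-2-g16-0`, 2026-08-24), sequel to the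
gen-15 file `…TropicalWeilVanishingCMWeights` (Theorem F1/F1⁺: no POLYNOMIAL periodic Stokes primitive for the Weil density,
even with coefficients depending on all torsion / congruence data). HONEST FRAMING: elementary algebra and asymptotics serving
a PAPER theorem about a METHOD (HOME `certificates/signedcycles/referee-tropical2-g15/NO-POLYNOMIAL-WEIL-CERTIFICATE.md` §5,
Theorem F1⁺⁺); it decides nothing about K1 (`TropicalWeilVanishing`, OPEN — an open problem) and nothing here bears on the
Hodge conjecture. negation-sink work.

The paper argument it serves. A candidate primitive `R(τ)(q) = Σ_J q_J·G_J(τ)` whose coefficients are PIECEWISE POLYNOMIAL in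
the archimedean facet data `ξ(τ)` — pieces indexed by the sign vector of finitely many real POLYNOMIAL wall functions `h_k(ξ)`
(walls and pieces depending arbitrarily on the isogeny-invariant data `α(τ)`; `max`/`min`/`|·|`/order statistics/sign predicates
of polynomials are of this form) — is transported along the orbit `c = x + iy ↦ [c]σ`, `c ≡ 1 (mod N)`, of a formal simplex.
The wall values `g(x, y) = h_k(xξ + yJξ)` are real polynomials in `(x, y)`. Far out along all sufficiently high rows of the orbit
every facet sits in ONE chamber, its ASYMPTOTIC chamber, which depends on the facet alone (`eventually_rows_sign_const`); the
coset points there have infinitely many infinite rows (`rows_infinite_of_eventually`); a polynomial identity on such a set is an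
identity (`mvPolynomial_eq_zero_of_infinite_rows`), so the transported Stokes identity splits CM-weight by CM-weight exactly as in
F1 (`cmCharacter_linearIndependent_of_rows`, sector form `cmCharacter_linearIndependent_sector`), and its weight-`(2n,0)`
coefficient is an `Ω(q)·ρ` identity with `ρ` a function of the facet — killed on `Θⁿ` by PHI-ANSATZ §2(a) (`μ(Θⁿ) > 0`).
Mathlib only; nothing is defined; no named fact; no sorry.

## References

* [Zharkov2020TropicalWeil] I. Zharkov, Tropical abelian varieties, Weil classes and the Hodge conjecture, arXiv:2002.02347
  (2020), pp. 2–4 (the CM of the tropical Weil family; Kontsevich's `Φ`; the finite ansatz).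
* [MikhalkinZharkov2014Eigenwave] G. Mikhalkin, I. Zharkov, Tropical eigenwave and intermediate Jacobians, LN UMI 15 (2014),
  Prop. 4.3 (push-forward of tropical cycles).
-/

set_option linter.dupNamespace false

namespace Summit.HodgeConjecture.HodgeConjecture.Theorems.TropicalWeilVanishing.CMWeights.SemiAlgebraic

open MvPolynomial Complex Filter
open Summit.HodgeConjecture.HodgeConjecture.Theorems.TropicalWeilVanishing.CMWeights

/-- A complex polynomial in two variables vanishing at the integer points of a set with infinitely many infinite ROWS (for
infinitely many `y ∈ T`, infinitely many `x` with `p(x, y) = 0`) is zero — e.g. the points of a lattice coset inside an open or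
truncated sector, or far out along high rows. (For each such `y` the one-variable polynomial `x ↦ p(x, y)` has infinitely many roots,
so `p` vanishes on `ℂ × T`, a box with infinite sides.) [folklore; Mathlib `MvPolynomial.funext_set`,
`Polynomial.eq_zero_of_infinite_isRoot`] -/
theorem mvPolynomial_eq_zero_of_infinite_rows {p : MvPolynomial (Fin 2) ℂ} (T : Set ℤ) (hT : T.Infinite)
    (h : ∀ y ∈ T, {x : ℤ | MvPolynomial.eval ![(x : ℂ), (y : ℂ)] p = 0}.Infinite) : p = 0 := by
  -- for y ∈ T the one-variable polynomial x ↦ p(x, y) has infinitely many roots, hence vanishes identically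
  have hrow : ∀ y ∈ T, ∀ t : ℂ, MvPolynomial.eval ![t, (y : ℂ)] p = 0 := by
    intro y hy t
    set r : Polynomial ℂ :=
      MvPolynomial.aeval ![(Polynomial.X : Polynomial ℂ), Polynomial.C (y : ℂ)] p with hr
    have hev : ∀ s : ℂ, Polynomial.eval s r = MvPolynomial.eval ![s, (y : ℂ)] p := by
      intro s
      rw [hr, ← Polynomial.coe_aeval_eq_eval, ← AlgHom.comp_apply, MvPolynomial.comp_aeval]
      rw [show (fun i => (Polynomial.aeval s) (![(Polynomial.X : Polynomial ℂ), Polynomial.C (y : ℂ)] i)) =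
          ![s, (y : ℂ)] from ?_]
      · rfl
      · funext i
        fin_cases i <;> simp
    have hr0 : r = 0 := by
      apply Polynomial.eq_zero_of_infinite_isRoot
      refine Set.Infinite.mono (s := ((↑) : ℤ → ℂ) '' {x : ℤ | MvPolynomial.eval ![(x : ℂ), (y : ℂ)] p = 0}) ?_ ?_
      · rintro _ ⟨x, hx, rfl⟩
        simp only [Set.mem_setOf_eq, Polynomial.IsRoot.def, hev]
        exact hx
      · exact ((h y hy).image Int.cast_injective.injOn)
    rw [← hev, hr0, Polynomial.eval_zero]
  refine MvPolynomial.funext_set ![Set.univ, ((↑) : ℤ → ℂ) '' T] (fun i => ?_) ?_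
  · fin_cases i
    · exact Set.infinite_univ
    · exact hT.image Int.cast_injective.injOn
  · intro x hx
    obtain ⟨y, hyT, hy⟩ : ∃ y : ℤ, y ∈ T ∧ (y : ℂ) = x 1 := by simpa using hx 1 (Set.mem_univ _)
    have hx' : x = ![x 0, (y : ℂ)] := by
      funext i; fin_cases i
      · rfl
      · simp [hy]
    rw [hx', map_zero]
    exact hrow y hyT (x 0)

/-- Coefficient extraction (via the gen-15 lemma `cmCharacter_linearIndependent`): if the character polynomial
`Σ_{w∈S} a_w (X₀ + iX₁)^{w.1} (X₀ − iX₁)^{w.2}` is the zero polynomial, all `a_w` vanish. [folklore] -/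
theorem coeff_eq_zero_of_charPoly_eq_zero' (S : Finset (ℕ × ℕ)) (a : ℕ × ℕ → ℂ)
    (hP : (∑ w ∈ S, C (a w) * (X 0 + C I * X 1) ^ w.1 * (X 0 - C I * X 1) ^ w.2 : MvPolynomial (Fin 2) ℂ) = 0) :
    ∀ w ∈ S, a w = 0 := by
  apply cmCharacter_linearIndependent S a
  intro x y
  have := congrArg (MvPolynomial.eval ![(x : ℂ), (y : ℂ)]) hP
  rw [map_zero] at this
  simp only [mul_comm ((y : ℤ) : ℂ) I]
  simpa [map_sum, map_mul, map_pow, map_add, map_sub, eval_C, eval_X] using this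

/-- **CM-weight separation on any set of Gaussian integers with infinitely many infinite rows.** If `Σ a_{κ,λ} c^κ c̄^λ = 0`
for all `c = x + iy` with `(x, y)` in such a set `G ⊆ ℤ²`, every coefficient vanishes. This is the splitting step of THEOREM F1⁺⁺:
the transported Stokes identity of a semi-algebraic candidate is a polynomial identity in `(x, y)` only on the part of the orbit
where all facets keep their asymptotic chambers — a set of this kind. [folklore] -/
theorem cmCharacter_linearIndependent_of_rows (S : Finset (ℕ × ℕ)) (a : ℕ × ℕ → ℂ) (G : Set (ℤ × ℤ))
    (hG : {y : ℤ | {x : ℤ | (x, y) ∈ G}.Infinite}.Infinite)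
    (h : ∀ xy ∈ G, ∑ w ∈ S, a w * ((xy.1 : ℂ) + (xy.2 : ℂ) * I) ^ w.1 * ((xy.1 : ℂ) - (xy.2 : ℂ) * I) ^ w.2 = 0) :
    ∀ w ∈ S, a w = 0 := by
  apply coeff_eq_zero_of_charPoly_eq_zero'
  apply mvPolynomial_eq_zero_of_infinite_rows {y : ℤ | {x : ℤ | (x, y) ∈ G}.Infinite} hG
  intro y hy
  refine Set.Infinite.mono (fun x hx => ?_) hy
  have := h (x, y) hx
  simp only [mul_comm ((y : ℤ) : ℂ) I] at this
  simpa [map_sum, map_mul, map_pow, map_add, map_sub, eval_C, eval_X] using this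

/-- **CM-weight separation on a (truncated) SECTOR of a congruence class.** The torsion-fixing isogenies `c = x + iy`,
`(x, y) ∈ (x₀ + Nℤ) × (y₀ + Nℤ)`, `N ≠ 0`, lying in a finite intersection of open half-planes `{w < u·x + v·y}` with `u > 0` — the
half-planes containing a far end of the positive real axis, e.g. the sector `{|y| < εx}` on which every facet of `[c]σ` keeps the
chamber of the corresponding facet of `σ` when the walls are LINEAR (`sign_wall_stable`), or a truncation `{|y| < εx, x > R}` of it —
still separate CM-weights. [folklore] -/
theorem cmCharacter_linearIndependent_sector (S : Finset (ℕ × ℕ)) (a : ℕ × ℕ → ℂ) (N x₀ y₀ : ℤ) (hN : N ≠ 0)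
    (H : Finset (ℝ × ℝ × ℝ)) (hH : ∀ uvw ∈ H, 0 < uvw.1)
    (h : ∀ k l : ℤ, (∀ uvw ∈ H, uvw.2.2 < uvw.1 * ((x₀ + N * k : ℤ) : ℝ) + uvw.2.1 * ((y₀ + N * l : ℤ) : ℝ)) →
      ∑ w ∈ S, a w * (((x₀ + N * k : ℤ) : ℂ) + ((y₀ + N * l : ℤ) : ℂ) * I) ^ w.1 *
        (((x₀ + N * k : ℤ) : ℂ) - ((y₀ + N * l : ℤ) : ℂ) * I) ^ w.2 = 0) :
    ∀ w ∈ S, a w = 0 := by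
  -- the set of good isogenies
  let G : Set (ℤ × ℤ) := {xy | ∃ k l : ℤ, xy = (x₀ + N * k, y₀ + N * l) ∧
    ∀ uvw ∈ H, uvw.2.2 < uvw.1 * ((x₀ + N * k : ℤ) : ℝ) + uvw.2.1 * ((y₀ + N * l : ℤ) : ℝ)}
  refine cmCharacter_linearIndependent_of_rows S a G ?_ ?_
  · -- every row y = y₀ + N l is infinite: x = x₀ + N·(N·m), m → ∞
    have hrow : ∀ l : ℤ, {x : ℤ | (x, y₀ + N * l) ∈ G}.Infinite := by
      intro l
      have hN2 : (0 : ℝ) < ((N * N : ℤ) : ℝ) := by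
        have : 0 < N * N := mul_self_pos.mpr hN
        exact_mod_cast this
      -- eventually (in m : ℕ) all the finitely many inequalities hold
      have hev : ∀ᶠ m : ℕ in atTop, ∀ uvw ∈ H,
          uvw.2.2 < uvw.1 * ((x₀ + N * (N * m) : ℤ) : ℝ) + uvw.2.1 * ((y₀ + N * l : ℤ) : ℝ) := by
        rw [Filter.eventually_all_finset]
        intro uvw huvw
        have hu := hH uvw huvw
        have ht : Tendsto (fun m : ℕ => uvw.1 * ((x₀ + N * (N * m) : ℤ) : ℝ) + uvw.2.1 * ((y₀ + N * l : ℤ) : ℝ))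
            atTop atTop := by
          have : (fun m : ℕ => uvw.1 * ((x₀ + N * (N * m) : ℤ) : ℝ) + uvw.2.1 * ((y₀ + N * l : ℤ) : ℝ)) =
              fun m : ℕ => (uvw.1 * ((N * N : ℤ) : ℝ)) * (m : ℝ) +
                (uvw.1 * (x₀ : ℝ) + uvw.2.1 * ((y₀ + N * l : ℤ) : ℝ)) := by
            funext m; push_cast; ring
          rw [this]
          exact tendsto_atTop_add_const_right _ _
            (Tendsto.const_mul_atTop (mul_pos hu hN2) tendsto_natCast_atTop_atTop)
        exact ht.eventually (eventually_gt_atTop _)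
      obtain ⟨m₀, hm₀⟩ := eventually_atTop.mp hev
      have hinj : Function.Injective (fun m : ℕ => x₀ + N * (N * ((m₀ + m : ℕ) : ℤ))) := by
        intro m m' hmm'
        have h1 : N * (N * ((m₀ + m : ℕ) : ℤ)) = N * (N * ((m₀ + m' : ℕ) : ℤ)) := by
          simpa using hmm'
        have h2 := mul_left_cancel₀ hN (mul_left_cancel₀ hN h1)
        have : (m₀ + m : ℕ) = m₀ + m' := by exact_mod_cast h2
        omega
      refine Set.infinite_of_injective_forall_mem hinj (fun m => ?_)
      exact ⟨N * ((m₀ + m : ℕ) : ℤ), l, rfl, hm₀ (m₀ + m) (Nat.le_add_right _ _)⟩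
    have hsub : (fun l : ℤ => y₀ + N * l) '' Set.univ ⊆ {y : ℤ | {x : ℤ | (x, y) ∈ G}.Infinite} := by
      rintro _ ⟨l, -, rfl⟩
      exact hrow l
    refine Set.Infinite.mono hsub (Set.infinite_univ.image ?_)
    intro l _ l' _ hl
    have : N * l = N * l' := by simpa using hl
    exact mul_left_cancel₀ hN this
  · rintro ⟨x, y⟩ ⟨k, l, hkl, hgood⟩
    obtain ⟨rfl, rfl⟩ := Prod.mk.inj hkl
    exact h k l hgood

/-- Chamber stability for a LINEAR wall along an isogeny orbit (REMARK F1⁺⁺'s original sector argument): if the wall functional has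
value `p = ℓ(ξ) ≠ 0` at a facet and `q = ℓ(Jξ)`, then at `[c]ξ = xξ + yJξ` its value `x·p + y·q` has the sign of `p` on the open
half-plane `{p²x + pq·y > 0}`, which contains `c = 1`. [folklore] -/
theorem sign_wall_stable {p q x y : ℝ} (hp : p ≠ 0) (hc : 0 < p ^ 2 * x + p * q * y) :
    SignType.sign (x * p + y * q) = SignType.sign p := by
  have hprod : 0 < p * (x * p + y * q) := by nlinarith
  rcases lt_or_gt_of_ne hp with hneg | hpos
  · have : x * p + y * q < 0 := by nlinarith
    rw [sign_neg this, sign_neg hneg]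
  · have : 0 < x * p + y * q := by nlinarith
    rw [sign_pos this, sign_pos hpos]

/-- Asymptotic sign of a real polynomial: for `t → +∞` the sign of `P(t)` is eventually the sign of its leading coefficient
(`P = 0` included). [folklore; Mathlib `Polynomial.tendsto_atTop_of_leadingCoeff_nonneg`] -/
theorem eventually_sign_eval_eq (P : Polynomial ℝ) :
    ∀ᶠ t : ℝ in atTop, SignType.sign (P.eval t) = SignType.sign P.leadingCoeff := by
  by_cases hdeg : 0 < P.degree
  · have hlc : P.leadingCoeff ≠ 0 :=
      Polynomial.leadingCoeff_ne_zero.mpr (Polynomial.ne_zero_of_degree_gt hdeg)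
    rcases lt_or_gt_of_ne hlc with hneg | hpos
    · have ht := P.tendsto_atBot_of_leadingCoeff_nonpos hdeg hneg.le
      filter_upwards [ht.eventually_lt_atBot 0] with t hlt
      rw [sign_neg hlt, sign_neg hneg]
    · have ht := P.tendsto_atTop_of_leadingCoeff_nonneg hdeg hpos.le
      filter_upwards [ht.eventually_gt_atTop 0] with t hgt
      rw [sign_pos hgt, sign_pos hpos]
  · have hP : P = Polynomial.C (P.coeff 0) := Polynomial.eq_C_of_degree_le_zero (not_lt.mp hdeg)
    refine Eventually.of_forall fun t => ?_
    rw [hP, Polynomial.eval_C, Polynomial.leadingCoeff_C]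

/-- **ASYMPTOTIC CHAMBERS.** Finitely many bivariate real polynomials `g = Σ_j a_j(y)·x^j` (outer variable `x`, coefficients
`a_j ∈ ℝ[y]`; value at `(x, y)` = `((g.map (evalRingHom y)).eval x`) have CONSTANT signs far out along all sufficiently high rows:
for all large `y` and then all large `x`, `sign g(x, y)` is the sign of the leading coefficient of the leading coefficient of `g`.
In THEOREM F1⁺⁺ this is applied to `g(x, y) = h([x + yJ]ξ)` for the finitely many polynomial walls `h` of the facets of one formal
simplex: on that part of the torsion-fixing isogeny orbit every facet sits in ONE chamber, which depends on the facet alone — so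
the weight-`(2n,0)` cochain extracted there is a function of the facet, as PHI-ANSATZ §2(a) needs. [folklore] -/
theorem eventually_rows_sign_const (G : Finset (Polynomial (Polynomial ℝ))) :
    ∀ᶠ y : ℝ in atTop, ∀ᶠ x : ℝ in atTop, ∀ g ∈ G,
      SignType.sign ((g.map (Polynomial.evalRingHom y)).eval x) =
        SignType.sign g.leadingCoeff.leadingCoeff := by
  have key : ∀ g : Polynomial (Polynomial ℝ), ∀ᶠ y : ℝ in atTop, ∀ᶠ x : ℝ in atTop,
      SignType.sign ((g.map (Polynomial.evalRingHom y)).eval x) =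
        SignType.sign g.leadingCoeff.leadingCoeff := by
    intro g
    by_cases hg : g = 0
    · subst hg
      exact Eventually.of_forall fun y => Eventually.of_forall fun x => by simp
    · have ha : g.leadingCoeff ≠ 0 := Polynomial.leadingCoeff_ne_zero.mpr hg
      filter_upwards [eventually_sign_eval_eq g.leadingCoeff,
        g.leadingCoeff.eventually_atTop_not_isRoot ha] with y hsign hroot
      have hne : Polynomial.evalRingHom y g.leadingCoeff ≠ 0 := hroot
      have hlc : (g.map (Polynomial.evalRingHom y)).leadingCoeff = g.leadingCoeff.eval y :=
        Polynomial.leadingCoeff_map_of_leadingCoeff_ne_zero _ hne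
      filter_upwards [eventually_sign_eval_eq (g.map (Polynomial.evalRingHom y))] with x hx
      rw [hx, hlc, hsign]
  have := fun g (_ : g ∈ G) => key g
  rw [← Filter.eventually_all_finset] at this
  filter_upwards [this] with y hy
  rw [← Filter.eventually_all_finset] at hy
  exact hy

/-- **ROW-RICH SETS INSIDE A CONGRUENCE CLASS.** If a property of integer points holds for all large `y` and then all large `x`
(real thresholds, e.g. the constancy of all asymptotic chambers from `eventually_rows_sign_const`), then the points of the coset
`(x₀ + Nℤ) × (y₀ + Nℤ)`, `N ≠ 0`, with the property contain infinitely many infinite rows — the hypothesis of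
`mvPolynomial_eq_zero_of_infinite_rows` / `cmCharacter_linearIndependent_of_rows`. [folklore] -/
theorem rows_infinite_of_eventually (P : ℤ → ℤ → Prop) (N x₀ y₀ : ℤ) (hN : N ≠ 0)
    (h : ∀ᶠ y : ℝ in atTop, ∀ᶠ x : ℝ in atTop, ∀ a b : ℤ, ((x₀ + N * a : ℤ) : ℝ) = x → ((y₀ + N * b : ℤ) : ℝ) = y →
      P (x₀ + N * a) (y₀ + N * b)) :
    {y : ℤ | {x : ℤ | (∃ a b : ℤ, x = x₀ + N * a ∧ y = y₀ + N * b) ∧ P x y}.Infinite}.Infinite := by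
  have hNN : 0 < N * N := mul_self_pos.mpr hN
  -- far-out coset points: t ↦ z₀ + N·(N·t), t : ℕ
  have far : ∀ (z₀ : ℤ) (R : ℝ), ∃ t₀ : ℕ, ∀ t : ℕ, t₀ ≤ t → R ≤ ((z₀ + N * (N * t) : ℤ) : ℝ) := by
    intro z₀ R
    obtain ⟨n, hn⟩ := exists_nat_ge (R - z₀)
    refine ⟨n, fun t ht => ?_⟩
    have h1 : (1 : ℝ) ≤ ((N * N : ℤ) : ℝ) := by exact_mod_cast hNN
    have ht' : (n : ℝ) ≤ t := by exact_mod_cast ht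
    have : (t : ℝ) ≤ ((N * N : ℤ) : ℝ) * t := by nlinarith
    push_cast at this ⊢
    nlinarith
  have inj : ∀ z₀ : ℤ, Function.Injective (fun t : ℕ => z₀ + N * (N * (t : ℤ))) := by
    intro z₀ t t' htt'
    have h1 : N * (N * (t : ℤ)) = N * (N * (t' : ℤ)) := by simpa using htt'
    exact_mod_cast mul_left_cancel₀ hN (mul_left_cancel₀ hN h1)
  obtain ⟨Ry, hRy⟩ := eventually_atTop.mp h
  obtain ⟨s₀, hs₀⟩ := far y₀ Ry
  -- the rows y = y₀ + N (N s), s ≥ s₀, are all infinite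
  have hrow : ∀ s : ℕ, s₀ ≤ s →
      {x : ℤ | (∃ a b : ℤ, x = x₀ + N * a ∧ y₀ + N * (N * (s : ℤ)) = y₀ + N * b) ∧
        P x (y₀ + N * (N * (s : ℤ)))}.Infinite := by
    intro s hs
    have hy := hRy _ (hs₀ s hs)
    obtain ⟨Rx, hRx⟩ := eventually_atTop.mp hy
    obtain ⟨t₀, ht₀⟩ := far x₀ Rx
    refine Set.infinite_of_injective_forall_mem (f := fun t : ℕ => x₀ + N * (N * ((t₀ + t : ℕ) : ℤ)))
      (fun t t' h' => by have := inj x₀ h'; omega) (fun t => ?_)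
    refine ⟨⟨N * ((t₀ + t : ℕ) : ℤ), N * (s : ℤ), rfl, rfl⟩, ?_⟩
    exact hRx _ (ht₀ (t₀ + t) (Nat.le_add_right _ _)) (N * ((t₀ + t : ℕ) : ℤ)) (N * (s : ℤ)) rfl rfl
  refine Set.infinite_of_injective_forall_mem (f := fun s : ℕ => y₀ + N * (N * ((s₀ + s : ℕ) : ℤ)))
    (fun s s' h' => by have := inj y₀ h'; omega) (fun s => ?_)
  exact hrow (s₀ + s) (Nat.le_add_right _ _)

end Summit.HodgeConjecture.HodgeConjecture.Theorems.TropicalWeilVanishing.CMWeights.SemiAlgebraic
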